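import Summits.BirchSwinnertonDyer.BirchSwinnertonDyer.Theorems.ManinLocalTwoThreeProductCertsOneEightyNineDE
import HarnessLib

/-!
# Level 189, class `189d` (weight 4): product certificates, part F

Cell `bsd-f2-manin`, route `ManinLocalTwoThree`, cruxes C2 `ManinOddAtFour` (stmt-BirchSwinnertonDyer-22967) / C3 `ManinPrimeToThreeAtNine` (stmt-22968); prover seat p2 gen 31;
`--supports` (helper).  WEIGHT-4 BRACKET–STURM for the class `189d` (optimal curve `189d1 = [0, 0, 1, -27, -7]`, `deg φ` too large for a weight-2 presentation):
`x∘φ = A/B` with `A = Σ_p alphaD_p · C_{i_p}·C_{j_p}`, `B = Σ_p betaD_p · C_{i_p}·C_{j_p}` over `78` products of an's `30` basis `η`-quotients of `M₂(Γ₀(189))`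
(exact linear algebra + LLL, seat p2 gen 31; the weight-`20` defect `216[A,B]² − F²(864A³ − 18c₄AB² − c₆B³)B` vanishes mod `q^482`, Sturm bound `480`).
HONEST FRAMING: kernel-checked identities of integer lists / elementary bookkeeping (standard axioms); nothing here proves C2/C3 for any `N`, Manin's conjecture or BSD.
[cite: Sturm1987, Thm. 1] [cite: AgasheRibetStein2006, §§1–2] [cite: Koehler2011, §2.1]
-/

set_option autoImplicit false
-- lint-debt: the directory name repeats the summit name (sibling precedent `ManinLocalTwoThreeManinConstantEightyEight.lean`)
set_option linter.dupNamespace false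

noncomputable section

open Complex
open UpperHalfPlane hiding I
open scoped MatrixGroups ModularForm
open ModularForm CongruenceSubgroup PowerSeries
open Literature.NumberTheory.ModularForms
open Literature.NumberTheory.EllipticCurves Literature.NumberTheory.EllipticCurves.ModularForms

namespace Summit.BirchSwinnertonDyer.BirchSwinnertonDyer.Theorems.ManinLocalTwoThree.LevelOneEightyNine

open Summit.BirchSwinnertonDyer.BirchSwinnertonDyer.Theorems.ManinLocalTwoThree.BracketSturm Summit.BirchSwinnertonDyer.BirchSwinnertonDyer.Theorems.ManinLocalTwoThree.PinningKernel Summit.BirchSwinnertonDyer.BirchSwinnertonDyer.Theorems.ManinLocalTwoThree.PinningOneEightyNine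
open Literature.NumberTheory.EllipticCurves.Rank1Residual.X11RankOneCertificates (discOf c4Of c6Of)

set_option maxHeartbeats 4000000
set_option maxRecDepth 16384

/-! ## Product certificates `65 … 77` -/

/-- `pTD 65 = tabsDeep 2 * tabsDeep 20` below `482` (kernel `decide`). [folklore] -/
theorem hpTD65 : mulList 482 (tabsDeep 2) (tabsDeep 20) = pTD 65 := by
  decide +kernel

/-- The table `pTD 65` agrees below `482` with the `q`-expansion of the weight-`4` form `C_2·C_20`. [folklore] -/
theorem hGD65 {C : Fin 30 → ModularForm (Gamma0 189) 2}
    (hi : ∀ n < 482, (((tabsDeep 2).getD n 0 : ℤ) : ℂ) = (qExpansion 1 ⇑(C 2)).coeff n)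
    (hj : ∀ n < 482, (((tabsDeep 20).getD n 0 : ℤ) : ℂ) = (qExpansion 1 ⇑(C 20)).coeff n) :
    ∀ n < 482, (((pTD 65).getD n 0 : ℤ) : ℂ) = (qExpansion 1 ⇑((C 2).mul (C 20))).coeff n := by
  rw [← hpTD65]; exact qExpansion_coeff_mul_eq_mulList (C 2) (C 20) hi hj

/-- `pTD 66 = tabsDeep 3 * tabsDeep 3` below `482` (kernel `decide`). [folklore] -/
theorem hpTD66 : mulList 482 (tabsDeep 3) (tabsDeep 3) = pTD 66 := by
  decide +kernel

/-- The table `pTD 66` agrees below `482` with the `q`-expansion of the weight-`4` form `C_3·C_3`. [folklore] -/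
theorem hGD66 {C : Fin 30 → ModularForm (Gamma0 189) 2}
    (hi : ∀ n < 482, (((tabsDeep 3).getD n 0 : ℤ) : ℂ) = (qExpansion 1 ⇑(C 3)).coeff n)
    (hj : ∀ n < 482, (((tabsDeep 3).getD n 0 : ℤ) : ℂ) = (qExpansion 1 ⇑(C 3)).coeff n) :
    ∀ n < 482, (((pTD 66).getD n 0 : ℤ) : ℂ) = (qExpansion 1 ⇑((C 3).mul (C 3))).coeff n := by
  rw [← hpTD66]; exact qExpansion_coeff_mul_eq_mulList (C 3) (C 3) hi hj

/-- `pTD 67 = tabsDeep 3 * tabsDeep 4` below `482` (kernel `decide`). [folklore] -/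
theorem hpTD67 : mulList 482 (tabsDeep 3) (tabsDeep 4) = pTD 67 := by
  decide +kernel

/-- The table `pTD 67` agrees below `482` with the `q`-expansion of the weight-`4` form `C_3·C_4`. [folklore] -/
theorem hGD67 {C : Fin 30 → ModularForm (Gamma0 189) 2}
    (hi : ∀ n < 482, (((tabsDeep 3).getD n 0 : ℤ) : ℂ) = (qExpansion 1 ⇑(C 3)).coeff n)
    (hj : ∀ n < 482, (((tabsDeep 4).getD n 0 : ℤ) : ℂ) = (qExpansion 1 ⇑(C 4)).coeff n) :
    ∀ n < 482, (((pTD 67).getD n 0 : ℤ) : ℂ) = (qExpansion 1 ⇑((C 3).mul (C 4))).coeff n := by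
  rw [← hpTD67]; exact qExpansion_coeff_mul_eq_mulList (C 3) (C 4) hi hj

/-- `pTD 68 = tabsDeep 3 * tabsDeep 5` below `482` (kernel `decide`). [folklore] -/
theorem hpTD68 : mulList 482 (tabsDeep 3) (tabsDeep 5) = pTD 68 := by
  decide +kernel

/-- The table `pTD 68` agrees below `482` with the `q`-expansion of the weight-`4` form `C_3·C_5`. [folklore] -/
theorem hGD68 {C : Fin 30 → ModularForm (Gamma0 189) 2}
    (hi : ∀ n < 482, (((tabsDeep 3).getD n 0 : ℤ) : ℂ) = (qExpansion 1 ⇑(C 3)).coeff n)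
    (hj : ∀ n < 482, (((tabsDeep 5).getD n 0 : ℤ) : ℂ) = (qExpansion 1 ⇑(C 5)).coeff n) :
    ∀ n < 482, (((pTD 68).getD n 0 : ℤ) : ℂ) = (qExpansion 1 ⇑((C 3).mul (C 5))).coeff n := by
  rw [← hpTD68]; exact qExpansion_coeff_mul_eq_mulList (C 3) (C 5) hi hj

/-- `pTD 69 = tabsDeep 3 * tabsDeep 7` below `482` (kernel `decide`). [folklore] -/
theorem hpTD69 : mulList 482 (tabsDeep 3) (tabsDeep 7) = pTD 69 := by
  decide +kernel

/-- The table `pTD 69` agrees below `482` with the `q`-expansion of the weight-`4` form `C_3·C_7`. [folklore] -/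
theorem hGD69 {C : Fin 30 → ModularForm (Gamma0 189) 2}
    (hi : ∀ n < 482, (((tabsDeep 3).getD n 0 : ℤ) : ℂ) = (qExpansion 1 ⇑(C 3)).coeff n)
    (hj : ∀ n < 482, (((tabsDeep 7).getD n 0 : ℤ) : ℂ) = (qExpansion 1 ⇑(C 7)).coeff n) :
    ∀ n < 482, (((pTD 69).getD n 0 : ℤ) : ℂ) = (qExpansion 1 ⇑((C 3).mul (C 7))).coeff n := by
  rw [← hpTD69]; exact qExpansion_coeff_mul_eq_mulList (C 3) (C 7) hi hj

/-- `pTD 70 = tabsDeep 3 * tabsDeep 8` below `482` (kernel `decide`). [folklore] -/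
theorem hpTD70 : mulList 482 (tabsDeep 3) (tabsDeep 8) = pTD 70 := by
  decide +kernel

/-- The table `pTD 70` agrees below `482` with the `q`-expansion of the weight-`4` form `C_3·C_8`. [folklore] -/
theorem hGD70 {C : Fin 30 → ModularForm (Gamma0 189) 2}
    (hi : ∀ n < 482, (((tabsDeep 3).getD n 0 : ℤ) : ℂ) = (qExpansion 1 ⇑(C 3)).coeff n)
    (hj : ∀ n < 482, (((tabsDeep 8).getD n 0 : ℤ) : ℂ) = (qExpansion 1 ⇑(C 8)).coeff n) :
    ∀ n < 482, (((pTD 70).getD n 0 : ℤ) : ℂ) = (qExpansion 1 ⇑((C 3).mul (C 8))).coeff n := by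
  rw [← hpTD70]; exact qExpansion_coeff_mul_eq_mulList (C 3) (C 8) hi hj

/-- `pTD 71 = tabsDeep 3 * tabsDeep 9` below `482` (kernel `decide`). [folklore] -/
theorem hpTD71 : mulList 482 (tabsDeep 3) (tabsDeep 9) = pTD 71 := by
  decide +kernel

/-- The table `pTD 71` agrees below `482` with the `q`-expansion of the weight-`4` form `C_3·C_9`. [folklore] -/
theorem hGD71 {C : Fin 30 → ModularForm (Gamma0 189) 2}
    (hi : ∀ n < 482, (((tabsDeep 3).getD n 0 : ℤ) : ℂ) = (qExpansion 1 ⇑(C 3)).coeff n)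
    (hj : ∀ n < 482, (((tabsDeep 9).getD n 0 : ℤ) : ℂ) = (qExpansion 1 ⇑(C 9)).coeff n) :
    ∀ n < 482, (((pTD 71).getD n 0 : ℤ) : ℂ) = (qExpansion 1 ⇑((C 3).mul (C 9))).coeff n := by
  rw [← hpTD71]; exact qExpansion_coeff_mul_eq_mulList (C 3) (C 9) hi hj

/-- `pTD 72 = tabsDeep 3 * tabsDeep 14` below `482` (kernel `decide`). [folklore] -/
theorem hpTD72 : mulList 482 (tabsDeep 3) (tabsDeep 14) = pTD 72 := by
  decide +kernel

/-- The table `pTD 72` agrees below `482` with the `q`-expansion of the weight-`4` form `C_3·C_14`. [folklore] -/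
theorem hGD72 {C : Fin 30 → ModularForm (Gamma0 189) 2}
    (hi : ∀ n < 482, (((tabsDeep 3).getD n 0 : ℤ) : ℂ) = (qExpansion 1 ⇑(C 3)).coeff n)
    (hj : ∀ n < 482, (((tabsDeep 14).getD n 0 : ℤ) : ℂ) = (qExpansion 1 ⇑(C 14)).coeff n) :
    ∀ n < 482, (((pTD 72).getD n 0 : ℤ) : ℂ) = (qExpansion 1 ⇑((C 3).mul (C 14))).coeff n := by
  rw [← hpTD72]; exact qExpansion_coeff_mul_eq_mulList (C 3) (C 14) hi hj

/-- `pTD 73 = tabsDeep 3 * tabsDeep 20` below `482` (kernel `decide`). [folklore] -/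
theorem hpTD73 : mulList 482 (tabsDeep 3) (tabsDeep 20) = pTD 73 := by
  decide +kernel

/-- The table `pTD 73` agrees below `482` with the `q`-expansion of the weight-`4` form `C_3·C_20`. [folklore] -/
theorem hGD73 {C : Fin 30 → ModularForm (Gamma0 189) 2}
    (hi : ∀ n < 482, (((tabsDeep 3).getD n 0 : ℤ) : ℂ) = (qExpansion 1 ⇑(C 3)).coeff n)
    (hj : ∀ n < 482, (((tabsDeep 20).getD n 0 : ℤ) : ℂ) = (qExpansion 1 ⇑(C 20)).coeff n) :
    ∀ n < 482, (((pTD 73).getD n 0 : ℤ) : ℂ) = (qExpansion 1 ⇑((C 3).mul (C 20))).coeff n := by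
  rw [← hpTD73]; exact qExpansion_coeff_mul_eq_mulList (C 3) (C 20) hi hj

/-- `pTD 74 = tabsDeep 4 * tabsDeep 4` below `482` (kernel `decide`). [folklore] -/
theorem hpTD74 : mulList 482 (tabsDeep 4) (tabsDeep 4) = pTD 74 := by
  decide +kernel

/-- The table `pTD 74` agrees below `482` with the `q`-expansion of the weight-`4` form `C_4·C_4`. [folklore] -/
theorem hGD74 {C : Fin 30 → ModularForm (Gamma0 189) 2}
    (hi : ∀ n < 482, (((tabsDeep 4).getD n 0 : ℤ) : ℂ) = (qExpansion 1 ⇑(C 4)).coeff n)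
    (hj : ∀ n < 482, (((tabsDeep 4).getD n 0 : ℤ) : ℂ) = (qExpansion 1 ⇑(C 4)).coeff n) :
    ∀ n < 482, (((pTD 74).getD n 0 : ℤ) : ℂ) = (qExpansion 1 ⇑((C 4).mul (C 4))).coeff n := by
  rw [← hpTD74]; exact qExpansion_coeff_mul_eq_mulList (C 4) (C 4) hi hj

/-- `pTD 75 = tabsDeep 4 * tabsDeep 5` below `482` (kernel `decide`). [folklore] -/
theorem hpTD75 : mulList 482 (tabsDeep 4) (tabsDeep 5) = pTD 75 := by
  decide +kernel

/-- The table `pTD 75` agrees below `482` with the `q`-expansion of the weight-`4` form `C_4·C_5`. [folklore] -/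
theorem hGD75 {C : Fin 30 → ModularForm (Gamma0 189) 2}
    (hi : ∀ n < 482, (((tabsDeep 4).getD n 0 : ℤ) : ℂ) = (qExpansion 1 ⇑(C 4)).coeff n)
    (hj : ∀ n < 482, (((tabsDeep 5).getD n 0 : ℤ) : ℂ) = (qExpansion 1 ⇑(C 5)).coeff n) :
    ∀ n < 482, (((pTD 75).getD n 0 : ℤ) : ℂ) = (qExpansion 1 ⇑((C 4).mul (C 5))).coeff n := by
  rw [← hpTD75]; exact qExpansion_coeff_mul_eq_mulList (C 4) (C 5) hi hj

/-- `pTD 76 = tabsDeep 4 * tabsDeep 8` below `482` (kernel `decide`). [folklore] -/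
theorem hpTD76 : mulList 482 (tabsDeep 4) (tabsDeep 8) = pTD 76 := by
  decide +kernel

/-- The table `pTD 76` agrees below `482` with the `q`-expansion of the weight-`4` form `C_4·C_8`. [folklore] -/
theorem hGD76 {C : Fin 30 → ModularForm (Gamma0 189) 2}
    (hi : ∀ n < 482, (((tabsDeep 4).getD n 0 : ℤ) : ℂ) = (qExpansion 1 ⇑(C 4)).coeff n)
    (hj : ∀ n < 482, (((tabsDeep 8).getD n 0 : ℤ) : ℂ) = (qExpansion 1 ⇑(C 8)).coeff n) :
    ∀ n < 482, (((pTD 76).getD n 0 : ℤ) : ℂ) = (qExpansion 1 ⇑((C 4).mul (C 8))).coeff n := by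
  rw [← hpTD76]; exact qExpansion_coeff_mul_eq_mulList (C 4) (C 8) hi hj

/-- `pTD 77 = tabsDeep 4 * tabsDeep 9` below `482` (kernel `decide`). [folklore] -/
theorem hpTD77 : mulList 482 (tabsDeep 4) (tabsDeep 9) = pTD 77 := by
  decide +kernel

/-- The table `pTD 77` agrees below `482` with the `q`-expansion of the weight-`4` form `C_4·C_9`. [folklore] -/
theorem hGD77 {C : Fin 30 → ModularForm (Gamma0 189) 2}
    (hi : ∀ n < 482, (((tabsDeep 4).getD n 0 : ℤ) : ℂ) = (qExpansion 1 ⇑(C 4)).coeff n)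
    (hj : ∀ n < 482, (((tabsDeep 9).getD n 0 : ℤ) : ℂ) = (qExpansion 1 ⇑(C 9)).coeff n) :
    ∀ n < 482, (((pTD 77).getD n 0 : ℤ) : ℂ) = (qExpansion 1 ⇑((C 4).mul (C 9))).coeff n := by
  rw [← hpTD77]; exact qExpansion_coeff_mul_eq_mulList (C 4) (C 9) hi hj


end Summit.BirchSwinnertonDyer.BirchSwinnertonDyer.Theorems.ManinLocalTwoThree.LevelOneEightyNine

end
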